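/-
Copyright (c) 2026. All rights reserved.
Released under Apache 2.0 license as described in the file LICENSE.
Authors: abc-iut cell, seat abc-iut-f-095 (gen 4; D-0079 L-F [AbsTop*] census hand), over the model settings of
abc-iut-w4-d095 and the observables engine of abc-iut-f-101.
-/
import Literature.AnabelianGeometry.AbsoluteAnabelian.LogFrobeniusLogWallArchOrigin
import Literature.AnabelianGeometry.AbsoluteAnabelian.LogFrobeniusObservablesOfIotaSquare
import Literature.AnabelianGeometry.AbsoluteAnabelian.LogFrobeniusTelecoreProofs
import Literature.AnabelianGeometry.AbsoluteAnabelian.LogFrobeniusCoresProofs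
import HarnessLib

/-!
# [AbsTopIII] Corollary 5.5 (iii), `⊞`-half (FACT-LIST F-0142 `Cor55Observables`), at the setting with GENUINE ARCHIMEDEAN components

S. Mochizuki, *Topics in absolute anabelian geometry III: global reconstruction algorithms*,
J. Math. Sci. Univ. Tokyo 22 (2015) 939–1156 [MochizukiAbsTopIII2015]; locators `p.N` = pages of the author's
manuscript (`paper:url-5493eb38cbb7`): Cor 5.5 (iii) p. 131 ("the natural transformations `ι⊞_{v,ε}` belong to a
family of homotopies on `D•_{≤3}` that determines on `D•_{≤2}` a structure of observable `S_log⊞`"), Def 5.4 (iii)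
p. 126 and (v) p. 127 (the graphs `Γ⃗^log_v`), Def 5.4 (vii) p. 128 (`ι⊞_{v,ε}`).

PROOF-ONLY companion (no `def`; nothing restated) for the cell's L-F programme (HOME/plan/L4/LF-ABSTOP.tsv row
F-0142, census abc-iut-f-095 2026-08-26T16:31Z: "at `archGenuine` no observables theorem is in the tree").  The
typed row `LogFrobeniusSetting.Cor55Observables` (`LogFrobeniusCorollaries.lean`, abc-iut-L4-t3) is EQUIVALENT to
the commutation of the `ι⊞`-squares (abc-iut-f-101, `cor55Observables_iff_iotaSquaresCommute`,
`LogFrobeniusObservablesOfIotaSquare.lean`); abc-iut-w4-d095 proved it at the two settings with genuine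
NONARCHIMEDEAN components (`nonarchGenuine_cor55Observables`, `nonarchGenuineMono_cor55Observables`).  Here: the
third setting with genuine components, `LogFrobeniusSetting.archGenuine 𝔄 Vmod isArc`
(`LogFrobeniusLogWallArchOrigin.lean`, abc-iut-w4-d095: GENUINE `ℰ• = EA`, `An• = LinHol`, archimedean
`λ⊞`/`ι⊞` = the printed graph `k~ →(id) k~ ↠(exp) k^× ↪ k` of Def 5.4 (v); PLACEHOLDER identities at the
nonarchimedean places):

* `archIota_squaresCommute_of_eq_false` — at a nonarchimedean place of THIS setting the `ι⊞` are the placeholder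
  identities (up to the canonical `eqToHom`), so any two composable pairs with the same ends have equal composites;
* `archGenuine_iotaSquaresCommute` — abc-iut-f-101's `IotaSquaresCommute` at EVERY place of `archGenuine`
  (archimedean places: f-101's `iotaSquaresCommute_of_isArc`, `Γ⃗^log_arc` being linear);
* `archGenuine_cor55Observables` — **F-0142 at `archGenuine`, ZERO binders**;
* `archGenuine_cor55Cores_observables_telecore` — Cor 5.5 (i) ∧ (iii)-⊞ ∧ (ii) jointly at `archGenuine` over an
  index set with a place (abc-iut-L4-t15's `cor55Cores_holds`, abc-iut-L4-t3/t15's `cor55Telecore_holds`).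

HONEST LABEL: at the genuine archimedean `ι⊞` the ⊞-observable condition is the linear-quiver triviality, and the
nonarchimedean components of this setting are placeholders — an instance at genuine-component data, not the printed
theorem for the printed Galois-theaters.  Refereed pre-IUT material; OUR kernel checks; nothing here bears on
[IUTchIII] Cor. 3.12; no side taken; typed ≠ proved.
-/

set_option autoImplicit false

noncomputable section

universe u

open CategoryTheory

namespace Literature.AnabelianGeometry.AbsoluteAnabelian

namespace LogFrobeniusSetting

variable (𝔄 : AutHolFieldFunctor.{u})

/-- At a NONARCHIMEDEAN place of `archGenuine` every `ι⊞`-component is the identity of the one object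
`λ^∼(X₀)` behind the canonical `eqToHom` (the components there are PLACEHOLDERS, `archIotaCore 𝔄 false _ = 𝟙`).
[cite: MochizukiAbsTopIII2015, Def 5.4 (vii) p.128] -/
theorem archIota_app_heq_id_of_false {μ₁ μ₂ : LogVertex false} (ε : LogEdge false μ₁ μ₂) (X₀ : Up (HolTFPair 𝔄)) :
    HEq ((archIota 𝔄 false ε).app X₀) (𝟙 ((Up.liftF (HolTFPair.lamSim 𝔄)).obj X₀)) := by
  simp only [archIota, archIotaCore, NatTrans.comp_app, eqToHom_app, NatTrans.id_app, eqToHom_comp_heq_iff]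
  rfl

/-- At a NONARCHIMEDEAN place of `archGenuine` (Boolean `b = false`, so that it applies to `b := isArc v` without
transport) any two composable pairs of `ι⊞`-components with common ends have the same composite: all four are the
identity of `λ^∼(X₀)` (`archIota_app_heq_id_of_false`). [cite: MochizukiAbsTopIII2015, Def 5.4 (vii) p.128] -/
theorem archIota_squaresCommute_of_eq_false (b : Bool) (hb : b = false) ⦃ν₁ ν₂ ν₂' ν₃ : LogVertex b⦄
    (ε₁₂ : LogEdge b ν₁ ν₂) (ε₂₃ : LogEdge b ν₂ ν₃) (ε₁₂' : LogEdge b ν₁ ν₂') (ε₂'₃ : LogEdge b ν₂' ν₃)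
    (X₀ : Up (HolTFPair 𝔄))
    (m₁₂ : (archLam 𝔄 b ν₁).obj X₀ ⟶ (archLam 𝔄 b ν₂).obj X₀)
    (m₂₃ : (archLam 𝔄 b ν₂).obj X₀ ⟶ (archLam 𝔄 b ν₃).obj X₀)
    (m₁₂' : (archLam 𝔄 b ν₁).obj X₀ ⟶ (archLam 𝔄 b ν₂').obj X₀)
    (m₂'₃ : (archLam 𝔄 b ν₂').obj X₀ ⟶ (archLam 𝔄 b ν₃).obj X₀)
    (hm₁₂ : HEq m₁₂ ((archIota 𝔄 b ε₁₂).app X₀)) (hm₂₃ : HEq m₂₃ ((archIota 𝔄 b ε₂₃).app X₀))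
    (hm₁₂' : HEq m₁₂' ((archIota 𝔄 b ε₁₂').app X₀)) (hm₂'₃ : HEq m₂'₃ ((archIota 𝔄 b ε₂'₃).app X₀)) :
    m₁₂ ≫ m₂₃ = m₁₂' ≫ m₂'₃ := by
  subst hb
  obtain rfl : m₁₂ = 𝟙 ((Up.liftF (HolTFPair.lamSim 𝔄)).obj X₀) :=
    eq_of_heq (hm₁₂.trans (archIota_app_heq_id_of_false 𝔄 ε₁₂ X₀))
  obtain rfl : m₂₃ = 𝟙 ((Up.liftF (HolTFPair.lamSim 𝔄)).obj X₀) :=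
    eq_of_heq (hm₂₃.trans (archIota_app_heq_id_of_false 𝔄 ε₂₃ X₀))
  obtain rfl : m₁₂' = 𝟙 ((Up.liftF (HolTFPair.lamSim 𝔄)).obj X₀) :=
    eq_of_heq (hm₁₂'.trans (archIota_app_heq_id_of_false 𝔄 ε₁₂' X₀))
  obtain rfl : m₂'₃ = 𝟙 ((Up.liftF (HolTFPair.lamSim 𝔄)).obj X₀) :=
    eq_of_heq (hm₂'₃.trans (archIota_app_heq_id_of_false 𝔄 ε₂'₃ X₀))
  rfl

variable (Vmod : Type (u + 1)) (isArc : Vmod → Bool)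

/-- **abc-iut-f-101's `IotaSquaresCommute` holds at EVERY place of the setting with genuine archimedean
components**: at an archimedean place by `iotaSquaresCommute_of_isArc` (`Γ⃗^log_arc` is the linear graph
`k~ → k~ → k^× → k`, two 2-chains with the same ends coincide), at a nonarchimedean place of this setting by
`archIota_squaresCommute_of_eq_false` (placeholder identities). [cite: MochizukiAbsTopIII2015, Def 5.4 (v) p.127] -/
theorem archGenuine_iotaSquaresCommute (v : Vmod) : (archGenuine 𝔄 Vmod isArc).IotaSquaresCommute v := by
  cases hb : isArc v
  · exact fun ν₁ ν₂ ν₂' ν₃ _ _ _ _ ε₁₂ ε₂₃ ε₁₂' ε₂'₃ X₀ m₁₂ m₂₃ m₁₂' m₂'₃ =>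
      archIota_squaresCommute_of_eq_false 𝔄 (isArc v) hb ε₁₂ ε₂₃ ε₁₂' ε₂'₃ X₀ m₁₂ m₂₃ m₁₂' m₂'₃
  · exact (archGenuine 𝔄 Vmod isArc).iotaSquaresCommute_of_isArc v hb

/-- **[AbsTopIII] Cor 5.5 (iii), `⊞`-half (`Cor55Observables`, FACT-LIST F-0142), HOLDS at the setting with genuine
ARCHIMEDEAN components, with zero binders**: for every `v ∈ V(F_mod)` the `ι⊞_{v,ε}` belong to a family of
homotopies determining an observable `S_log⊞` on `D•_{≤2}` — by abc-iut-f-101's `cor55Observables_of_iotaSquaresCommute`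
and `archGenuine_iotaSquaresCommute`.  Together with abc-iut-w4-d095's `nonarchGenuine_cor55Observables` /
`nonarchGenuineMono_cor55Observables`, F-0142 now holds at all three settings of the tree carrying genuine components.
[cite: MochizukiAbsTopIII2015, Cor 5.5 (iii) p.131] -/
theorem archGenuine_cor55Observables : (archGenuine 𝔄 Vmod isArc).Cor55Observables :=
  (archGenuine 𝔄 Vmod isArc).cor55Observables_of_iotaSquaresCommute (archGenuine_iotaSquaresCommute 𝔄 Vmod isArc)

/-- **Cor 5.5 (i) ∧ (iii)-⊞ ∧ (ii) JOINTLY at `archGenuine`** over an index set with a place: the cores `ℰ• = EA`,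
`An•[𝒳] = LinHol`, `ℰ•` (abc-iut-L4-t15's `cor55Cores_holds`), the observables `S_log⊞_v`
(`archGenuine_cor55Observables`), and the telecore `𝔗_{An•}` with its contact structure (`cor55Telecore_holds`).
[cite: MochizukiAbsTopIII2015, Cor 5.5 (i)–(iii) pp.130–131] -/
theorem archGenuine_cor55Cores_observables_telecore [Nonempty Vmod] :
    (archGenuine 𝔄 Vmod isArc).Cor55Cores ∧ (archGenuine 𝔄 Vmod isArc).Cor55Observables ∧
      (archGenuine 𝔄 Vmod isArc).Cor55Telecore :=
  ⟨(archGenuine 𝔄 Vmod isArc).cor55Cores_holds, archGenuine_cor55Observables 𝔄 Vmod isArc,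
    (archGenuine 𝔄 Vmod isArc).cor55Telecore_holds⟩

/-- Binder-free form over an index set with a named place `v₀` (archimedean or not).
[cite: MochizukiAbsTopIII2015, Cor 5.5 (i)–(iii) pp.130–131] -/
theorem archGenuine_cor55Cores_observables_telecore_of_mem (v₀ : Vmod) :
    (archGenuine 𝔄 Vmod isArc).Cor55Cores ∧ (archGenuine 𝔄 Vmod isArc).Cor55Observables ∧
      (archGenuine 𝔄 Vmod isArc).Cor55Telecore :=
  haveI : Nonempty Vmod := ⟨v₀⟩
  archGenuine_cor55Cores_observables_telecore 𝔄 Vmod isArc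

end LogFrobeniusSetting

end Literature.AnabelianGeometry.AbsoluteAnabelian

end
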